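import Summits.Ventures.QEC.Census.CertBZList
import Summits.Ventures.QEC.Census.TwoBGA.TB_l6m24_A0_0_0_1_3_11_B0_0_1_11_5_4.Q144.L1Iface
import HarnessLib

set_option Elab.async false
set_option maxRecDepth 200000

/-!
# `quotient-[[144,12,d_Z≥8]]` one-level cover certificate of `TB_l6m24_A0_0_0_1_3_11_B0_0_1_11_5_4.Q144` — LEVEL-1 objects: decided structure facts (`L1Rows`; qec-search-1 g5)

On the objects of `L1Iface`: the rows of both systematic matrices are words below `2^72` and there are 36 of them (hypotheses of the
`CertBZPlaneTree` leaves), the structural verdict `blockStructOK 72 7 eGb eBlock` (both matrices systematic on their information sets,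
`|Aᵢ| = |eGb| = 36`, recounted Brouwer–Zimmermann bound `(3+1)+(2+1) = 7`), and every word of the orbit list `eOrb` is below `2^72`
(hypothesis `hallow` of `CertBZList.mem_allow_of_struct_reaches`). Theorems only; `decide +kernel`; KERNEL. (Pattern of search-9 g5 `L1Rows` p535898.)
-/

namespace Summit.Ventures.QEC.Census.TB_l6m24_A0_0_0_1_3_11_B0_0_1_11_5_4.Q144

open Summit.Ventures.QEC.Census

/-- Rows of level-1 matrix 0 are words below `2^72`. -/
theorem eG0_lt : ∀ g ∈ giRows TB_l6m24_A0_0_0_1_3_11_B0_0_1_11_5_4.Q144.eGb eM0, g < 2 ^ 72 := by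
  have h : ((giRows eGb eM0).all fun g => decide (g < 2 ^ 72)) = true := by decide +kernel
  simpa [List.all_eq_true] using h

/-- Rows of level-1 matrix 1 are words below `2^72`. -/
theorem eG1_lt : ∀ g ∈ giRows TB_l6m24_A0_0_0_1_3_11_B0_0_1_11_5_4.Q144.eGb eM1, g < 2 ^ 72 := by
  have h : ((giRows eGb eM1).all fun g => decide (g < 2 ^ 72)) = true := by decide +kernel
  simpa [List.all_eq_true] using h

/-- Matrix 0 has 36 rows. -/
theorem eG0_len : (giRows TB_l6m24_A0_0_0_1_3_11_B0_0_1_11_5_4.Q144.eGb eM0).length = 36 := by decide +kernel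

/-- Matrix 1 has 36 rows. -/
theorem eG1_len : (giRows TB_l6m24_A0_0_0_1_3_11_B0_0_1_11_5_4.Q144.eGb eM1).length = 36 := by decide +kernel

/-- STRUCTURE of the level-1 block (type-10 `blockStructOK`): both matrices systematic on `T₀` / `T₁` with rows below `2^72`,
`|Aᵢ| = 36`, and the recounted bound reaches `7`. -/
theorem eBlock_struct : blockStructOK 72 7 TB_l6m24_A0_0_0_1_3_11_B0_0_1_11_5_4.Q144.eGb eBlock = true := by decide +kernel

set_option maxHeartbeats 400000000 in
/-- Every word of the orbit list is below `2^72` (one kernel pass over `eOrb`). -/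
theorem eOrb_lt : ∀ w ∈ TB_l6m24_A0_0_0_1_3_11_B0_0_1_11_5_4.Q144.eOrb, w < 2 ^ 72 := by
  have h : (eOrb.all fun w => decide (w < 2 ^ 72)) = true := by decide +kernel
  simpa [List.all_eq_true] using h

end Summit.Ventures.QEC.Census.TB_l6m24_A0_0_0_1_3_11_B0_0_1_11_5_4.Q144
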